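import Summits.Ventures.PercRepro.C025ProfileHallParallel

/-!
# C-033 «SHADOW HALL (H⁺)» — the deletion–contraction step at a point OUTSIDE the family, every `q` (night-3 g7)

For a finite matroid `M`, a non-loop `e` and a family `𝒜` of rank-`q` sets with `e ∉ cl(B)` for every member `B`
(so `e ∉ B` and `B` keeps its rank `q` in `M ／ {e}`), the shadow at level `u+1` splits along `e ∈ S`:

  `#∂^M_{u+1} 𝒜  ≥  #∂^{M＼e}_{u+1} 𝒜 + #∂^{M／e}_u 𝒜`      (`card_shadowLevel_ge_of_notMem`)

(the `e`-free part IS the `M ＼ e`-shadow, `filter_notMem_shadowLevel_eq`; `S ↦ S.erase e` sends the `e`-part into the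
`M ／ e`-shadow one level down, `card_shadow_contract_le_of_notMem`), and every member pays at most in the two minors
together:

  `price_M q (u+1) B ≤ price_{M＼e} q (u+1) B + price_{M／e} q u B`      (`price_le_price_delete_add_price_contract`).

With `p := ρ_M(E ∖ B)` (`≥ 1`, `e ∈ E ∖ B` is a non-loop), `ρ_{M／e}((E∖e)∖B) = p − 1` and `ρ_{M＼e}((E∖e)∖B) ∈ {p−1, p}`, the
price inequality is `Pq q p (u+1) ≤ Pq q p' (u+1) + Pq q (p−1) u` with `Pq q p u = [u ≤ p]·C(p+q,u)/C(p+q,q)`: trivial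
for `p' = p`, and for `p' = p − 1` it is Pascal `C(p+q−1,u+1) + C(p+q−1,u) = C(p+q,u+1)` over `C(p+q−1,q) ≤ C(p+q,q)`
when `u + 1 ≤ p − 1`, and `1 = 1` when `u + 1 = p` (`Pq_pascal`).

**`hallIneq_of_delete_contract`**: `(H⁺_{q,u+1})(M ＼ e)` and `(H⁺_{q,u})(M ／ e)` give the Hall inequality of `M` at
`(q, u+1)` on every family avoiding `e` in the closure sense. It is the step used by `hallIneq_one_all`
(`C025ProfileHallOne`) for the simple case of the row `q = 1`; at `q ≥ 2` it is a SUPPORT (the members touching `e`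
are not covered).
-/

open scoped Matroid

namespace PercRepro

open Set Finset ThmH

section PqBinomial

/-- `Pq q p u = [u ≤ p]·C(p+q,u)/C(p+q,q)`: the profile price at `(q, u)` of a set whose complement has rank `p`. -/
noncomputable def Pq (q p u : ℕ) : ℚ :=
  if u ≤ p then (Nat.choose (p + q) u : ℚ) / (Nat.choose (p + q) q : ℚ) else 0

/-- `Pq ≥ 0`. -/
theorem Pq_nonneg (q p u : ℕ) : 0 ≤ Pq q p u := by
  unfold Pq
  split_ifs
  · exact div_nonneg (Nat.cast_nonneg _) (Nat.cast_nonneg _)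
  · exact le_rfl

/-- The price of `B` at `(q, u)` is `Pq q (ρ(E ∖ B)) u`. -/
theorem price_eq_Pq {α : Type} [DecidableEq α] (N : Matroid α) [N.Finite] (q u : ℕ) (B : Finset α) :
    Profile.price N q u B = Pq q (N.eRk ((gr N \ B : Finset α) : Set α)).toNat u := by
  have hfin : N.eRk ((gr N \ B : Finset α) : Set α) ≠ ⊤ := by
    rw [← lt_top_iff_ne_top]; exact (N.isRkFinite_set _).eRk_lt_top
  unfold Profile.price Pq
  rw [← ENat.coe_toNat hfin, ENat.toNat_coe]
  by_cases hu : u ≤ (N.eRk ((gr N \ B : Finset α) : Set α)).toNat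
  · rw [if_pos (by exact_mod_cast hu), if_pos hu]
  · rw [if_neg (by exact_mod_cast hu), if_neg hu]

/-- **Pascal for the profile prices**: `Pq q (p+1) (u+1) ≤ Pq q p (u+1) + Pq q p u`. -/
theorem Pq_pascal (q p u : ℕ) : Pq q (p + 1) (u + 1) ≤ Pq q p (u + 1) + Pq q p u := by
  unfold Pq
  by_cases h1 : u + 1 ≤ p
  · -- both minor terms live: Pascal over C(p+q,q) ≤ C(p+q+1,q)
    rw [if_pos (by omega), if_pos h1, if_pos (by omega)]
    have hsum : (Nat.choose (p + 1 + q) (u + 1) : ℚ) = Nat.choose (p + q) (u + 1) + Nat.choose (p + q) u := by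
      rw [show p + 1 + q = p + q + 1 by ring, Nat.choose_succ_succ' (p + q) u]
      push_cast; ring
    have hpos : (0 : ℚ) < Nat.choose (p + q) q := by exact_mod_cast Nat.choose_pos (by omega)
    have hpos' : (0 : ℚ) < Nat.choose (p + 1 + q) q := by exact_mod_cast Nat.choose_pos (by omega)
    have hle : (Nat.choose (p + q) q : ℚ) ≤ Nat.choose (p + 1 + q) q := by
      exact_mod_cast Nat.choose_le_choose q (by omega)
    have hnum : (0 : ℚ) ≤ Nat.choose (p + 1 + q) (u + 1) := Nat.cast_nonneg _
    rw [hsum, ← add_div, ← hsum]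
    exact div_le_div_of_nonneg_left hnum hpos hle
  · by_cases h2 : u + 1 ≤ p + 1
    · -- u = p: the contraction term alone pays: 1 ≤ 0 + 1
      have hup : u = p := by omega
      subst hup
      rw [if_pos (le_refl _), if_neg h1, if_pos (le_refl _)]
      have hA : (Nat.choose (u + 1 + q) (u + 1) : ℚ) / (Nat.choose (u + 1 + q) q : ℚ) = 1 := by
        rw [Nat.choose_symm_add]
        exact div_self (by exact_mod_cast (Nat.choose_pos (by omega)).ne')
      have hB : (Nat.choose (u + q) u : ℚ) / (Nat.choose (u + q) q : ℚ) = 1 := by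
        rw [Nat.choose_symm_add]
        exact div_self (by exact_mod_cast (Nat.choose_pos (by omega)).ne')
      rw [hA, hB]; linarith
    · rw [if_neg h2]
      split_ifs <;> positivity

end PqBinomial

section HallDelete

variable {α : Type} [DecidableEq α] {M : Matroid α} [M.Finite]

/-- **The price inequality at a non-loop `e` outside `B`**: at levels `u+1` / `u+1` / `u`,
`price_M B ≤ price_{M＼e} B + price_{M／e} B`. -/
theorem price_le_price_delete_add_price_contract {e : α} (he : M.Indep {e}) (q u : ℕ) {B : Finset α}
    (hB : B ⊆ (gr M).erase e) :
    Profile.price M q (u + 1) B ≤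
      Profile.price (M ＼ ({e} : Set α)) q (u + 1) B + Profile.price (M ／ ({e} : Set α)) q u B := by
  have heE : e ∈ gr M := by rw [← Finset.mem_coe, coe_gr]; exact he.subset_ground (Set.mem_singleton e)
  rw [price_eq_Pq, price_eq_Pq, price_eq_Pq, coe_sdiff_eq_insert hB heE, gr_delete_singleton'', gr_contract_singleton,
    coe_erase_sdiff, delete_singleton_eRk_eq Set.sdiff_subset]
  set X : Set α := (M.E \ {e}) \ (B : Set α) with hX
  have hsub : X ⊆ M.E \ {e} := Set.sdiff_subset
  have hc := contract_singleton_eRk_add_one he hsub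
  have hfinI : M.eRk (insert e X) ≠ ⊤ := by
    rw [← lt_top_iff_ne_top]; exact (M.isRkFinite_set _).eRk_lt_top
  have hfinX : M.eRk X ≠ ⊤ := by
    rw [← lt_top_iff_ne_top]; exact (M.isRkFinite_set _).eRk_lt_top
  have hfinc : (M ／ ({e} : Set α)).eRk X ≠ ⊤ := by
    rw [← lt_top_iff_ne_top]; exact ((M ／ ({e} : Set α)).isRkFinite_set _).eRk_lt_top
  set rI := (M.eRk (insert e X)).toNat with hrI
  set rX := (M.eRk X).toNat with hrX
  set rc := ((M ／ ({e} : Set α)).eRk X).toNat with hrc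
  have hrel : rc + 1 = rI := by
    have : ((rc + 1 : ℕ) : ℕ∞) = (rI : ℕ∞) := by
      push_cast
      rw [hrc, hrI, ENat.coe_toNat hfinc, ENat.coe_toNat hfinI]
      exact hc
    exact_mod_cast this
  have hXI : rX ≤ rI := by
    have : M.eRk X ≤ M.eRk (insert e X) := M.eRk_mono (Set.subset_insert _ _)
    rw [← ENat.coe_toNat hfinX, ← ENat.coe_toNat hfinI] at this
    exact_mod_cast this
  have hIX : rI ≤ rX + 1 := by
    have : M.eRk (insert e X) ≤ M.eRk X + 1 := M.eRk_insert_le_add_one e X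
    rw [← ENat.coe_toNat hfinX, ← ENat.coe_toNat hfinI] at this
    exact_mod_cast this
  rw [← hrel]
  rcases Nat.eq_or_lt_of_le hXI with h | h
  · -- ρ(X) = ρ(insert e X): the deletion term alone pays
    rw [h, ← hrel]
    linarith [Pq_nonneg q rc u]
  · have hrX' : rX = rc := by omega
    rw [hrX']
    exact Pq_pascal q rc u

/-- The `M ／ {e}`-shadow (level `u`) of any family embeds, via `insert e`, into the part of the `M`-shadow
(level `u+1`) containing `e`. -/
theorem card_shadow_contract_le_of_notMem {e : α} (he : M.Indep {e}) (u : ℕ) (𝒜 : Finset (Finset α)) :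
    (Shadow.shadowLevel (M ／ ({e} : Set α)) u 𝒜).card ≤
      ((Shadow.shadowLevel M (u + 1) 𝒜).filter (fun S => e ∈ S)).card := by
  have hlev := image_erase_filter_mem_levelSet_eq (M := M) he u
  apply Finset.card_le_card_of_injOn (fun S' => insert e S')
  · intro S' hS'
    rw [Finset.mem_coe, mem_shadowLevel] at hS'
    obtain ⟨hS'lev, B, hB, hBS'⟩ := hS'
    rw [← hlev, Finset.mem_image] at hS'lev
    obtain ⟨S, hS, rfl⟩ := hS'lev
    rw [Finset.mem_filter] at hS
    rw [Finset.mem_coe, Finset.mem_filter]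
    dsimp only
    rw [Finset.insert_erase hS.2, mem_shadowLevel]
    refine ⟨⟨hS.1, B, hB, ?_⟩, hS.2⟩
    intro x hx
    exact (Finset.mem_erase.1 (hBS' hx)).2
  · intro S₁ hS₁ S₂ hS₂ h
    simp only at h
    rw [Finset.mem_coe, mem_shadowLevel] at hS₁ hS₂
    have h₁ : e ∉ S₁ := by
      intro heS
      have := hS₁.1
      rw [Profile.mem_levelSet, gr_contract_singleton] at this
      exact (Finset.mem_erase.1 (this.1 heS)).1 rfl
    have h₂ : e ∉ S₂ := by
      intro heS
      have := hS₂.1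
      rw [Profile.mem_levelSet, gr_contract_singleton] at this
      exact (Finset.mem_erase.1 (this.1 heS)).1 rfl
    rw [← Finset.erase_insert h₁, ← Finset.erase_insert h₂, h]

/-- **The shadow split at a non-loop `e` outside the family**:
`#∂^{M＼e}_{u+1} 𝒜 + #∂^{M／e}_u 𝒜 ≤ #∂^M_{u+1} 𝒜`. -/
theorem card_shadowLevel_ge_of_notMem {e : α} (he : M.Indep {e}) (u : ℕ) {𝒜 : Finset (Finset α)}
    (h𝒜 : ∀ B ∈ 𝒜, e ∉ B) :
    (Shadow.shadowLevel (M ＼ ({e} : Set α)) (u + 1) 𝒜).card +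
      (Shadow.shadowLevel (M ／ ({e} : Set α)) u 𝒜).card ≤ (Shadow.shadowLevel M (u + 1) 𝒜).card := by
  have hfilt : 𝒜.filter (fun B => e ∉ B) = 𝒜 := Finset.filter_true_of_mem h𝒜
  have h1 := filter_notMem_shadowLevel_eq (M := M) e (u + 1) 𝒜
  rw [hfilt] at h1
  rw [← h1]
  calc ((Shadow.shadowLevel M (u + 1) 𝒜).filter (fun S => e ∉ S)).card +
        (Shadow.shadowLevel (M ／ ({e} : Set α)) u 𝒜).card
      ≤ ((Shadow.shadowLevel M (u + 1) 𝒜).filter (fun S => e ∉ S)).card +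
        ((Shadow.shadowLevel M (u + 1) 𝒜).filter (fun S => e ∈ S)).card :=
        Nat.add_le_add_left (card_shadow_contract_le_of_notMem he u 𝒜) _
    _ = (Shadow.shadowLevel M (u + 1) 𝒜).card := by
        rw [add_comm, Finset.card_filter_add_card_filter_not]

/-- A rank-`q` set of `M` avoiding `e` is a rank-`q` set of `M ＼ {e}`. -/
theorem mem_Rq_delete_of_notMem {q : ℕ} {e : α} {B : Finset α} (hB : B ∈ Profile.Rq M q) (heB : e ∉ B) :
    B ∈ Profile.Rq (M ＼ ({e} : Set α)) q := by
  rw [Profile.mem_Rq] at hB ⊢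
  rw [gr_delete_singleton'']
  refine ⟨fun x hx => Finset.mem_erase.2 ⟨fun h => heB (h ▸ hx), hB.1 hx⟩, ?_⟩
  rw [delete_singleton_eRk_eq]
  · exact hB.2
  · intro x hx
    exact ⟨by rw [← coe_gr]; exact_mod_cast hB.1 hx, by rw [Set.mem_singleton_iff]; rintro rfl; exact heB hx⟩

/-- A rank-`q` set `B` of `M` with `e ∉ cl(B)` (`e` a non-loop) is a rank-`q` set of `M ／ {e}`. -/
theorem mem_Rq_contract_of_notMem_closure {q : ℕ} {e : α} (he : M.Indep {e}) {B : Finset α}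
    (hB : B ∈ Profile.Rq M q) (hcl : e ∉ M.closure (B : Set α)) :
    B ∈ Profile.Rq (M ／ ({e} : Set α)) q := by
  have heE : e ∈ M.E := he.subset_ground (Set.mem_singleton e)
  rw [Profile.mem_Rq] at hB ⊢
  have heB : e ∉ B := fun h => hcl (M.subset_closure _ (by rw [← coe_gr]; exact_mod_cast hB.1) (by exact_mod_cast h))
  have hBE : (B : Set α) ⊆ M.E \ {e} := by
    intro x hx
    exact ⟨by rw [← coe_gr]; exact_mod_cast hB.1 hx, by rw [Set.mem_singleton_iff]; rintro rfl; exact heB hx⟩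
  rw [gr_contract_singleton]
  refine ⟨fun x hx => Finset.mem_erase.2 ⟨fun h => heB (h ▸ hx), hB.1 hx⟩, ?_⟩
  have h1 := contract_singleton_eRk_add_one he hBE
  rw [M.eRk_insert_eq_add_one ⟨heE, hcl⟩, hB.2] at h1
  exact WithTop.add_right_cancel (ENat.coe_ne_top 1) h1

/-- **The deletion–contraction step of `(H⁺_{q,u+1})` at a point outside the family**: for a non-loop `e` and a family
`𝒜` of rank-`q` sets with `e ∉ cl(B)` for every member, `(H⁺_{q,u+1})(M ＼ e)` and `(H⁺_{q,u})(M ／ e)` give the Hall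
inequality of `M` on `𝒜` at level `u+1`. -/
theorem hallIneq_of_delete_contract {e : α} (he : M.Indep {e}) (q u : ℕ)
    (h1 : Profile.HallIneq (M ＼ ({e} : Set α)) q (u + 1)) (h2 : Profile.HallIneq (M ／ ({e} : Set α)) q u)
    {𝒜 : Finset (Finset α)} (h𝒜 : 𝒜 ⊆ Profile.Rq M q) (hcl : ∀ B ∈ 𝒜, e ∉ M.closure (B : Set α)) :
    ∑ B ∈ 𝒜, Profile.price M q (u + 1) B ≤ ((Shadow.shadowLevel M (u + 1) 𝒜).card : ℚ) := by
  have heB : ∀ B ∈ 𝒜, e ∉ B := by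
    intro B hB h
    have hBR := h𝒜 hB
    rw [Profile.mem_Rq] at hBR
    exact hcl B hB (M.subset_closure _ (by rw [← coe_gr]; exact_mod_cast hBR.1) (by exact_mod_cast h))
  have hsubE : ∀ B ∈ 𝒜, B ⊆ (gr M).erase e := by
    intro B hB x hx
    have hBR := h𝒜 hB
    rw [Profile.mem_Rq] at hBR
    exact Finset.mem_erase.2 ⟨fun h => heB B hB (h ▸ hx), hBR.1 hx⟩
  have hA1 : 𝒜 ⊆ Profile.Rq (M ＼ ({e} : Set α)) q := fun B hB => mem_Rq_delete_of_notMem (h𝒜 hB) (heB B hB)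
  have hA2 : 𝒜 ⊆ Profile.Rq (M ／ ({e} : Set α)) q :=
    fun B hB => mem_Rq_contract_of_notMem_closure he (h𝒜 hB) (hcl B hB)
  have hp : ∑ B ∈ 𝒜, Profile.price M q (u + 1) B ≤
      ∑ B ∈ 𝒜, Profile.price (M ＼ ({e} : Set α)) q (u + 1) B + ∑ B ∈ 𝒜, Profile.price (M ／ ({e} : Set α)) q u B := by
    rw [← Finset.sum_add_distrib]
    exact Finset.sum_le_sum (fun B hB => price_le_price_delete_add_price_contract he q u (hsubE B hB))
  have hd := h1 𝒜 hA1
  have hc := h2 𝒜 hA2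
  have hs : ((Shadow.shadowLevel (M ＼ ({e} : Set α)) (u + 1) 𝒜).card : ℚ) +
      ((Shadow.shadowLevel (M ／ ({e} : Set α)) u 𝒜).card : ℚ) ≤ ((Shadow.shadowLevel M (u + 1) 𝒜).card : ℚ) := by
    exact_mod_cast card_shadowLevel_ge_of_notMem he u heB
  linarith

end HallDelete

end PercRepro
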